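import Summits.QuantumFields.QCD.Theorems.WilsonMobilityGapChiralMobilityGapAnchorCoreDefs
import Literature.MathematicalPhysics.QuantumFieldTheory.QCDPhaseQuenchedAEInvertible

/-!
# Crux `ChiralMobilityGap` (stmt-QuantumFields-17497) — line `Ideator3Sketch`: the ROW-IDENTITY SHELL FLOOR
# (helper toward node `AnchorFloorFinite` = stub `stub_floorFinite`)

The one piece of rigorous LOWER-bound information presently available on the phase-quenched moments
`fm N_f β b S f v s = E₊[(Σ_{a,i,c,j} |G_f(U)((0,a,i),(v,c,j))|)^s]` (currency of clause (iii) and of node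
`AnchorFloorFinite`) is the unit-shell floor of the row identity; here it is in `fm`-currency, for EVERY bare tuple
`b`, coupling `β`, half-side `S`, flavour `f`, with the honest constant `½` (the tree's Literature rule has `1`):
`12 ≤ |b_f + 4|·fm(0,1) + ½ Σ_μ (fm(e_μ,1) + fm(−e_μ,1))` (`fm_shell_floor`; `fm_shell_floor_rpow` for `0 < s ≤ 1`
with `12^s`, `|b_f+4|^s`, `(½)^s`; `fm_shell_floor_folded` folds `−e_μ` onto `e_μ` by parity).  Hence one of the five
moments `fm(0,1)`, `fm(e_μ,1)` is `≥ 12/(|b_f + 4| + 4)` (`exists_shell_fm_ge`), and along the anchored degenerate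
trajectory of `anchorReg N_f` (`-1 < b_f(k) ≤ a_k t/Z_m(k)`) `≥ 12/(8 + a_k t/Z_m(k))`, uniformly in volume and
flavour (`anchor_shell_fm_ge`): node `AnchorFloorFinite` cannot fail SIMULTANEOUSLY on the unit shell `{0, ±e_μ}` of
the source.  Nothing is said at separations `n ≥ 2` — that is the open content of the node.

Proof: for `det D_W ≠ 0` the row identity `Σ_q G(p,q) D_W(q,p) = 1` (`G = D_W⁻¹`), summed over the `4N` colour–spin
indices at the source, with the SHARP entry bounds `|D_W(q,p)| ≤ |m+4| δ_{qp} + ½·#{nearest-neighbour relations}`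
(in the chiral basis `γ_μ` has zero diagonal, so every entry of `1 ∓ γ_μ` has modulus `≤ 1`; `|ρ(U)_{ca}| ≤ 1`),
gives `4N ≤ |m+4| X(x) + ½ Σ_μ (X(x+μ̂) + X(x−μ̂))` for the block sums `X` (`wilsonPropagator_blockSum_sumRule_half`;
`Literature/…/QCDPropagatorNeighbourhoodLowerBound` has the rule with the coarser constant `1`).  Under the
phase-quenched probability measure every sea determinant is a.s. non-zero (`ae_fermionDet_ne_zero_qcdLatticeMeasure`),
`fm` is the `s`-th moment of `X` (`fm_eq_integral`) and `t ↦ t^s` is subadditive; integrate.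
-/

noncomputable section

namespace Summit.QuantumFields.QCD.Theorems.ChiralMobilityGapAnchor

open scoped BigOperators Topology
open MeasureTheory Filter Set
open Literature.MathematicalPhysics.QuantumFieldTheory Literature.MathematicalPhysics.QuantumLattice
  Literature.Probability.LatticeModels
open Summit.QuantumFields.QCD.Theorems.MobilityGapNegative (bare fm)
open Summit.QuantumFields.QCD.Theorems.MobilityGapSketch (propSum propSum_nonneg integrable_propSum_rpow
  fm_eq_integral negativeFm_eq_fm)

/-! ### §1 Sharp entry bounds for the Wilson spin matrices `1 ∓ γ_μ` -/

/-- In the chiral basis every Euclidean gamma matrix has zero diagonal. -/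
theorem euclideanGamma_apply_self (μ i : Fin 4) : euclideanGamma μ i i = 0 := by
  fin_cases μ <;> fin_cases i <;>
    simp [euclideanGamma_zero, euclideanGamma_one, euclideanGamma_two, euclideanGamma_three]

/-- Entries of the gamma matrices have modulus `≤ 1` (`γ_μ` is unitary: `γ_μᴴ γ_μ = γ_μ² = 1`). -/
theorem norm_euclideanGamma_apply_le_one (μ α β : Fin 4) : ‖euclideanGamma μ α β‖ ≤ 1 := by
  refine entry_norm_bound_of_unitary (Matrix.mem_unitaryGroup_iff'.mpr ?_) α β
  rw [Matrix.star_eq_conjTranspose, (euclideanGamma_isHermitian μ).eq, euclideanGamma_mul_self]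

/-- **Sharp bounds** `|(1 ∓ γ_μ)_{αβ}| ≤ 1`: the entry is `1` on the diagonal and `∓(γ_μ)_{αβ}` off it
(the tree's `norm_one_sub_add_euclideanGamma_apply_le` has `2`). -/
theorem norm_one_sub_add_euclideanGamma_apply_le_one (μ α β : Fin 4) :
    ‖(((1 : ℝ) : ℂ) • (1 : Matrix (Fin 4) (Fin 4) ℂ) - euclideanGamma μ) α β‖ ≤ 1 ∧
      ‖(((1 : ℝ) : ℂ) • (1 : Matrix (Fin 4) (Fin 4) ℂ) + euclideanGamma μ) α β‖ ≤ 1 := by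
  simp only [Matrix.sub_apply, Matrix.add_apply, Complex.ofReal_one, one_smul, Matrix.one_apply]
  by_cases h : α = β
  · subst h; simp [euclideanGamma_apply_self]
  · rw [if_neg h, zero_sub, norm_neg, zero_add]
    exact ⟨norm_euclideanGamma_apply_le_one μ α β, norm_euclideanGamma_apply_le_one μ α β⟩

/-! ### §2 The row and star sum rules at constant `½`, configuration-wise -/

section Torus

variable {L N : ℕ} {G : Type*} [Group G] (ρ : G →* Matrix (Fin N) (Fin N) ℂ)

/-- **Sharp entry bound for the Wilson–Dirac matrix** (`r = 1`, unitary `ρ`): `|D_W(q,p)|` is at most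
`|m+4|` on the diagonal plus ONE HALF for each of the (at most eight) nearest-neighbour relations `q = p ∓ μ̂`
between the sites (`½ · |(1∓γ_μ)_{ij}| · |ρ(U)_{ab}| ≤ ½`). -/
theorem norm_wilsonDirac_apply_le_half (hρ : ∀ g, ρ g ∈ Matrix.unitaryGroup (Fin N) ℂ)
    (U : GaugeConfig 4 L G) (m : ℝ) (q p : TorusSite 4 L × Fin N × Fin 4) :
    ‖wilsonDirac ρ U m 1 q p‖ ≤
      |m + 4| * (if q = p then 1 else 0) +
        (1 / 2 : ℝ) * ∑ μ : Fin 4, ((if q.1 = p.1 + Pi.single μ 1 then (1 : ℝ) else 0) +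
          (if q.1 = p.1 - Pi.single μ 1 then (1 : ℝ) else 0)) := by
  -- adapted from Literature/…/QCDPropagatorNeighbourhoodLowerBound.norm_wilsonDirac_apply_le (constant 2 ↦ 1)
  rw [wilsonDirac, Matrix.of_apply]
  refine (norm_sub_le _ _).trans (add_le_add ?_ ?_)
  · split_ifs with h
    · rw [Complex.norm_real, Real.norm_eq_abs, mul_one, mul_one]
    · simp
  · have hA : ∀ μ : Fin 4,
        ‖(if p.1 = Literature.MathematicalPhysics.QuantumFieldTheory.Site.shift q.1 μ then
            ((((1 : ℝ) : ℂ)) • (1 : Matrix (Fin 4) (Fin 4) ℂ) - euclideanGamma μ) q.2.2 p.2.2 *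
              ρ (U (q.1, μ)) q.2.1 p.2.1 else 0)‖ ≤
          (if q.1 = p.1 - Pi.single μ 1 then (1 : ℝ) else 0) := by
      intro μ
      split_ifs with h1 h2 h2
      · rw [norm_mul]
        exact (mul_le_mul (norm_one_sub_add_euclideanGamma_apply_le_one μ _ _).1
          (entry_norm_bound_of_unitary (hρ _) _ _) (norm_nonneg _) zero_le_one).trans_eq (mul_one 1)
      · exact absurd (by rw [h1, Literature.MathematicalPhysics.QuantumFieldTheory.Site.shift, add_sub_cancel_right]) h2
      all_goals simp
    have hB : ∀ μ : Fin 4,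
        ‖(if q.1 = Literature.MathematicalPhysics.QuantumFieldTheory.Site.shift p.1 μ then
            ((((1 : ℝ) : ℂ)) • (1 : Matrix (Fin 4) (Fin 4) ℂ) + euclideanGamma μ) q.2.2 p.2.2 *
              ρ (U (p.1, μ))⁻¹ q.2.1 p.2.1 else 0)‖ ≤
          (if q.1 = p.1 + Pi.single μ 1 then (1 : ℝ) else 0) := by
      intro μ
      split_ifs with h1 h2 h2
      · rw [norm_mul]
        exact (mul_le_mul (norm_one_sub_add_euclideanGamma_apply_le_one μ _ _).2
          (entry_norm_bound_of_unitary (hρ _) _ _) (norm_nonneg _) zero_le_one).trans_eq (mul_one 1)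
      · exact absurd (by rw [h1]; rfl) h2
      all_goals simp
    have hhalf : ‖(1 / 2 : ℂ)‖ = 1 / 2 := by norm_num
    rw [norm_mul, hhalf]
    refine mul_le_mul_of_nonneg_left ((norm_sum_le _ _).trans (Finset.sum_le_sum fun μ _ =>
      (norm_add_le _ _).trans ?_)) (by norm_num)
    linarith [hA μ, hB μ]

variable [NeZero L]

/-- Row sums over a fixed sink site: `Σ_q F(q) [q.1 = y] = Σ_{b,j} F(y,b,j)`. -/
private theorem sum_ite_site_eq (F : TorusSite 4 L × Fin N × Fin 4 → ℝ) (y : TorusSite 4 L) :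
    ∑ q : TorusSite 4 L × Fin N × Fin 4, F q * (if q.1 = y then (1 : ℝ) else 0) =
      ∑ b : Fin N, ∑ j : Fin 4, F (y, b, j) := by
  -- adapted from Literature/…/QCDPropagatorNeighbourhoodLowerBound (private `starRule_sum_ite_site_eq`)
  rw [Fintype.sum_prod_type]
  simp only [mul_ite, mul_one, mul_zero]
  simp_rw [Finset.sum_ite_irrel, Finset.sum_const_zero]
  rw [Finset.sum_ite_eq' Finset.univ y, if_pos (Finset.mem_univ y), Fintype.sum_prod_type]

/-- **Row sum rule at constant `½`** (every real bare mass, every gauge field with `det D_W ≠ 0`, every index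
`p = (x,a,i)`): `1 ≤ |m+4|·|G(p,p)| + ½ Σ_μ Σ_{b,j} (|G(p,(x+μ̂,b,j))| + |G(p,(x−μ̂,b,j))|)`, from
`1 = Σ_q G(p,q) D_W(q,p)` and `norm_wilsonDirac_apply_le_half`. -/
theorem wilsonPropagator_row_sumRule_half (hρ : ∀ g, ρ g ∈ Matrix.unitaryGroup (Fin N) ℂ)
    (U : GaugeConfig 4 L G) (m : ℝ) (hdet : (wilsonDirac ρ U m 1).det ≠ 0)
    (x : TorusSite 4 L) (a : Fin N) (i : Fin 4) :
    1 ≤ |m + 4| * ‖(wilsonDirac ρ U m 1)⁻¹ (x, a, i) (x, a, i)‖ +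
      (1 / 2 : ℝ) * ∑ μ : Fin 4, ((∑ b : Fin N, ∑ j : Fin 4,
          ‖(wilsonDirac ρ U m 1)⁻¹ (x, a, i) (x + Pi.single μ 1, b, j)‖) +
        (∑ b : Fin N, ∑ j : Fin 4,
          ‖(wilsonDirac ρ U m 1)⁻¹ (x, a, i) (x - Pi.single μ 1, b, j)‖)) := by
  -- adapted from Literature/…/QCDPropagatorNeighbourhoodLowerBound.wilsonPropagator_row_sumRule
  set W := wilsonDirac ρ U m 1
  set p : TorusSite 4 L × Fin N × Fin 4 := (x, a, i)
  have h1 := congr_fun (congr_fun (Matrix.nonsing_inv_mul W (isUnit_iff_ne_zero.2 hdet)) p) p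
  rw [Matrix.mul_apply, Matrix.one_apply_eq] at h1
  -- `1 = |Σ_q G(p,q) D(q,p)| ≤ Σ_q |G(p,q)| · (|m+4| δ_{qp} + ½ Σ_μ (𝟙[q = p+μ̂] + 𝟙[q = p-μ̂]))`
  have h3 : (1 : ℝ) ≤ ∑ q, ‖W⁻¹ p q‖ * (|m + 4| * (if q = p then 1 else 0) +
      (1 / 2 : ℝ) * ∑ μ : Fin 4, ((if q.1 = p.1 + Pi.single μ 1 then (1 : ℝ) else 0) +
        (if q.1 = p.1 - Pi.single μ 1 then (1 : ℝ) else 0))) :=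
    calc (1 : ℝ) = ‖∑ q, W⁻¹ p q * W q p‖ := by rw [h1, norm_one]
      _ ≤ ∑ q, ‖W⁻¹ p q‖ * ‖W q p‖ :=
          (norm_sum_le _ _).trans_eq (Finset.sum_congr rfl fun q _ => norm_mul _ _)
      _ ≤ _ := Finset.sum_le_sum fun q _ =>
          mul_le_mul_of_nonneg_left (norm_wilsonDirac_apply_le_half ρ hρ U m q p) (norm_nonneg _)
  have hdiag : ∑ q, ‖W⁻¹ p q‖ * (|m + 4| * (if q = p then (1 : ℝ) else 0)) = |m + 4| * ‖W⁻¹ p p‖ := by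
    simp only [mul_ite, mul_one, mul_zero]
    rw [Finset.sum_ite_eq' Finset.univ p, if_pos (Finset.mem_univ p), mul_comm]
  have hhop : ∑ q, ‖W⁻¹ p q‖ * ∑ μ : Fin 4, ((if q.1 = p.1 + Pi.single μ 1 then (1 : ℝ) else 0) +
        (if q.1 = p.1 - Pi.single μ 1 then (1 : ℝ) else 0)) =
      ∑ μ : Fin 4, ((∑ b : Fin N, ∑ j : Fin 4, ‖W⁻¹ p (x + Pi.single μ 1, b, j)‖) +
        (∑ b : Fin N, ∑ j : Fin 4, ‖W⁻¹ p (x - Pi.single μ 1, b, j)‖)) := by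
    simp only [Finset.mul_sum, mul_add]
    rw [Finset.sum_comm]
    refine Finset.sum_congr rfl fun μ _ => ?_
    rw [Finset.sum_add_distrib, sum_ite_site_eq (fun q => ‖W⁻¹ p q‖) (x + Pi.single μ 1),
      sum_ite_site_eq (fun q => ‖W⁻¹ p q‖) (x - Pi.single μ 1)]
  refine h3.trans_eq ?_
  rw [← hdiag, ← hhop, Finset.mul_sum, ← Finset.sum_add_distrib]
  exact Finset.sum_congr rfl fun q _ => by ring

/-- Moving a triple sum's innermost index outermost. -/
private theorem sum_sum_sum_comm_inner {α β γ : Type*} [Fintype α] [Fintype β] [Fintype γ]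
    (P : α → β → γ → ℝ) : ∑ a, ∑ i, ∑ μ, P a i μ = ∑ μ, ∑ a, ∑ i, P a i μ :=
  -- adapted from Literature/…/QCDPropagatorNeighbourhoodLowerBound (private `starRule_sum_sum_sum_comm_inner`)
  calc ∑ a, ∑ i, ∑ μ, P a i μ = ∑ a, ∑ μ, ∑ i, P a i μ := Finset.sum_congr rfl fun _ _ => Finset.sum_comm
    _ = ∑ μ, ∑ a, ∑ i, P a i μ := Finset.sum_comm

/-- Bookkeeping: `Σ_{a,i} (c·d + κ Σ_μ (P + Q)) = c·Σ d + κ Σ_μ (Σ P + Σ Q)`. -/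
private theorem sum_sum_rearrange {α β γ : Type*} [Fintype α] [Fintype β] [Fintype γ] (c κ : ℝ)
    (d : α → β → ℝ) (P Q : α → β → γ → ℝ) :
    ∑ a, ∑ i, (c * d a i + κ * ∑ μ, (P a i μ + Q a i μ)) =
      c * (∑ a, ∑ i, d a i) + κ * ∑ μ, ((∑ a, ∑ i, P a i μ) + (∑ a, ∑ i, Q a i μ)) := by
  -- adapted from Literature/…/QCDPropagatorNeighbourhoodLowerBound (private `starRule_sum_sum_rearrange`)
  simp only [Finset.sum_add_distrib, Finset.mul_sum, mul_add]
  rw [sum_sum_sum_comm_inner (fun a i μ => κ * P a i μ), sum_sum_sum_comm_inner (fun a i μ => κ * Q a i μ)]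

/-- **Star sum rule at constant `½` for the colour–spin block sums of the Wilson quark propagator** (every
real bare mass, every gauge field with `det D_W ≠ 0`, every source site `x`): with
`X(y) := Σ_{a,i,b,j} |G((x,a,i),(y,b,j))|`, `4N ≤ |m+4|·X(x) + ½ Σ_μ (X(x+μ̂) + X(x−μ̂))`. -/
theorem wilsonPropagator_blockSum_sumRule_half (hρ : ∀ g, ρ g ∈ Matrix.unitaryGroup (Fin N) ℂ)
    (U : GaugeConfig 4 L G) (m : ℝ) (hdet : (wilsonDirac ρ U m 1).det ≠ 0) (x : TorusSite 4 L) :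
    4 * (N : ℝ) ≤
      |m + 4| * (∑ a : Fin N, ∑ i : Fin 4, ∑ b : Fin N, ∑ j : Fin 4,
          ‖(wilsonDirac ρ U m 1)⁻¹ (x, a, i) (x, b, j)‖) +
        (1 / 2 : ℝ) * ∑ μ : Fin 4, ((∑ a : Fin N, ∑ i : Fin 4, ∑ b : Fin N, ∑ j : Fin 4,
            ‖(wilsonDirac ρ U m 1)⁻¹ (x, a, i) (x + Pi.single μ 1, b, j)‖) +
          (∑ a : Fin N, ∑ i : Fin 4, ∑ b : Fin N, ∑ j : Fin 4,
            ‖(wilsonDirac ρ U m 1)⁻¹ (x, a, i) (x - Pi.single μ 1, b, j)‖)) := by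
  -- adapted from Literature/…/QCDPropagatorNeighbourhoodLowerBound.wilsonPropagator_blockSum_sumRule
  set W := wilsonDirac ρ U m 1
  have hsum := Finset.sum_le_sum (s := Finset.univ) fun a _ =>
    Finset.sum_le_sum (s := Finset.univ) fun i _ => wilsonPropagator_row_sumRule_half ρ hρ U m hdet x a i
  have hN : ∑ _a : Fin N, ∑ _i : Fin 4, (1 : ℝ) = 4 * (N : ℝ) := by
    simp only [Finset.sum_const, Finset.card_univ, Fintype.card_fin, nsmul_eq_mul, mul_one]
    ring
  rw [hN] at hsum
  -- rearrange and bound the diagonal entries by the full block sum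
  have hdiag : ∀ (a : Fin N) (i : Fin 4), ‖W⁻¹ (x, a, i) (x, a, i)‖ ≤
      ∑ b : Fin N, ∑ j : Fin 4, ‖W⁻¹ (x, a, i) (x, b, j)‖ := fun a i =>
    (Finset.single_le_sum (f := fun j : Fin 4 => ‖W⁻¹ (x, a, i) (x, a, j)‖) (fun _ _ => norm_nonneg _)
      (Finset.mem_univ i)).trans (Finset.single_le_sum (f := fun b : Fin N => ∑ j, ‖W⁻¹ (x, a, i) (x, b, j)‖)
      (fun _ _ => Finset.sum_nonneg fun _ _ => norm_nonneg _) (Finset.mem_univ a))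
  refine hsum.trans (le_of_eq_of_le (sum_sum_rearrange |m + 4| (1 / 2) (fun a i => ‖W⁻¹ (x, a, i) (x, a, i)‖)
    (fun a i μ => ∑ b : Fin N, ∑ j : Fin 4, ‖W⁻¹ (x, a, i) (x + Pi.single μ 1, b, j)‖)
    (fun a i μ => ∑ b : Fin N, ∑ j : Fin 4, ‖W⁻¹ (x, a, i) (x - Pi.single μ 1, b, j)‖)) ?_)
  gcongr with a _ i _
  exact hdiag a i

end Torus

/-! ### §3 The phase-quenched shell floor in `fm`-currency -/

section QCD

variable {Nf : ℕ}

/-- `proj 0 ± μ̂ = proj (±e_μ)` on the torus. -/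
private theorem torusProj_zero_add_sub_single (T : ℕ) (μ : Fin 4) :
    Torus.proj T (0 : Literature.Probability.LatticeModels.Site 4) + Pi.single μ 1 =
        Torus.proj T (Pi.single μ (1 : ℤ)) ∧
      Torus.proj T (0 : Literature.Probability.LatticeModels.Site 4) - Pi.single μ 1 =
        Torus.proj T (Pi.single μ (-1 : ℤ)) := by
  refine ⟨funext fun i => ?_, funext fun i => ?_⟩ <;>
  · by_cases h : i = μ
    · subst h; simp [Torus.proj_apply]
    · simp [Torus.proj_apply, Pi.single_eq_of_ne h]

/-- Subadditivity of `t ↦ t ^ s` (`0 < s ≤ 1`) over finite sums of non-negative reals. -/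
private theorem rpow_finsetSum_le {ι : Type*} (T : Finset ι) (g : ι → ℝ) (hg : ∀ i ∈ T, 0 ≤ g i)
    {s : ℝ} (hs0 : 0 < s) (hs1 : s ≤ 1) : (∑ i ∈ T, g i) ^ s ≤ ∑ i ∈ T, g i ^ s := by
  -- adapted from Literature.Probability.Moments.rpow_sum_le_sum_rpow
  classical
  induction T using Finset.induction_on with
  | empty => simp [Real.zero_rpow hs0.ne']
  | insert a T ha ih =>
    have hg' : ∀ i ∈ T, 0 ≤ g i := fun i hi => hg i (Finset.mem_insert_of_mem hi)
    rw [Finset.sum_insert ha, Finset.sum_insert ha]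
    calc (g a + ∑ i ∈ T, g i) ^ s ≤ g a ^ s + (∑ i ∈ T, g i) ^ s :=
          Real.rpow_add_le_add_rpow (hg a (Finset.mem_insert_self a T)) (Finset.sum_nonneg hg') hs0.le hs1
      _ ≤ g a ^ s + ∑ i ∈ T, g i ^ s := by gcongr; exact ih hg'

/-- **Configuration-wise shell floor for the entry sums** (`N_f` flavours, `SU(3)`, torus side `2S+1`, source
`0`): at every gauge field where all sea determinants are non-zero,
`12 ≤ |b_f + 4| · X_{f,0}(U) + ½ Σ_μ (X_{f,e_μ}(U) + X_{f,−e_μ}(U))`. -/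
theorem propSum_shell_floor {S : ℕ} (b : Fin Nf → ℝ) (f : Fin Nf) (U : GaugeConfig 4 (2 * S + 1) SU3)
    (hU : ∀ g, (wilsonDirac (fundamentalRep (Fin 3)) U (b g) 1).det ≠ 0) :
    (12 : ℝ) ≤ |b f + 4| * propSum Nf S b f 0 U +
      (1 / 2 : ℝ) * ∑ μ : Fin 4, (propSum Nf S b f (Pi.single μ 1) U + propSum Nf S b f (Pi.single μ (-1)) U) := by
  have hstar := wilsonPropagator_blockSum_sumRule_half (fundamentalRep (Fin 3))
    fundamentalRep_mem_unitaryGroup U (b f) (hU f) (Torus.proj (2 * S + 1) 0)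
  simp only [torusProj_zero_add_sub_single] at hstar
  have hX : ∀ v, propSum Nf S b f v U = ∑ a : Fin 3, ∑ i : Fin 4, ∑ c : Fin 3, ∑ j : Fin 4,
      ‖(wilsonDirac (fundamentalRep (Fin 3)) U (b f) 1)⁻¹ (Torus.proj (2 * S + 1) 0, a, i)
        (Torus.proj (2 * S + 1) v, c, j)‖ := fun v => by
    simp only [propSum, inv_diracMatrix_apply_same_flavour U b hU f]
  simp only [hX]
  have h12 : (4 : ℝ) * ((3 : ℕ) : ℝ) = 12 := by norm_num
  rw [h12] at hstar
  exact hstar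

/-- The same, in `s`-th-power currency (`0 < s ≤ 1`, subadditivity of `t ↦ t^s`):
`12^s ≤ |b_f + 4|^s X_0^s + (½)^s Σ_μ (X_{e_μ}^s + X_{−e_μ}^s)`. -/
theorem propSum_shell_floor_rpow {S : ℕ} (b : Fin Nf → ℝ) (f : Fin Nf) (U : GaugeConfig 4 (2 * S + 1) SU3)
    (hU : ∀ g, (wilsonDirac (fundamentalRep (Fin 3)) U (b g) 1).det ≠ 0) {s : ℝ} (hs0 : 0 < s)
    (hs1 : s ≤ 1) :
    (12 : ℝ) ^ s ≤ |b f + 4| ^ s * propSum Nf S b f 0 U ^ s +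
      (1 / 2 : ℝ) ^ s * ∑ μ : Fin 4,
        (propSum Nf S b f (Pi.single μ 1) U ^ s + propSum Nf S b f (Pi.single μ (-1)) U ^ s) := by
  have h12 := propSum_shell_floor b f U hU
  have hP0 : ∀ v, 0 ≤ propSum Nf S b f v U := fun v => propSum_nonneg Nf S b f v U
  set T := ∑ μ : Fin 4, (propSum Nf S b f (Pi.single μ 1) U + propSum Nf S b f (Pi.single μ (-1)) U)
  have hT0 : 0 ≤ T := Finset.sum_nonneg fun μ _ => add_nonneg (hP0 _) (hP0 _)
  calc (12 : ℝ) ^ s ≤ (|b f + 4| * propSum Nf S b f 0 U + (1 / 2 : ℝ) * T) ^ s :=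
        Real.rpow_le_rpow (by norm_num) h12 hs0.le
    _ ≤ (|b f + 4| * propSum Nf S b f 0 U) ^ s + ((1 / 2 : ℝ) * T) ^ s :=
        Real.rpow_add_le_add_rpow (mul_nonneg (abs_nonneg _) (hP0 0)) (mul_nonneg (by norm_num) hT0) hs0.le hs1
    _ ≤ _ := by
        rw [Real.mul_rpow (abs_nonneg _) (hP0 0), Real.mul_rpow (by norm_num) hT0]
        gcongr
        refine (rpow_finsetSum_le _ _ (fun μ _ => add_nonneg (hP0 _) (hP0 _)) hs0 hs1).trans ?_
        exact Finset.sum_le_sum fun μ _ => Real.rpow_add_le_add_rpow (hP0 _) (hP0 _) hs0.le hs1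

/-- **THE SHELL FLOOR, fractional-moment form.**  For every `N_f`, coupling `β`, bare tuple `b`, half-side `S`,
flavour `f` and `0 < s ≤ 1`:
`12^s ≤ |b_f + 4|^s · fm(0, s) + (½)^s · Σ_μ (fm(e_μ, s) + fm(−e_μ, s))`. -/
theorem fm_shell_floor_rpow (β : ℝ) (b : Fin Nf → ℝ) (S : ℕ) (f : Fin Nf) {s : ℝ} (hs0 : 0 < s)
    (hs1 : s ≤ 1) :
    (12 : ℝ) ^ s ≤ |b f + 4| ^ s * fm Nf β b S f 0 s +
      (1 / 2 : ℝ) ^ s * ∑ μ : Fin 4, (fm Nf β b S f (Pi.single μ 1) s + fm Nf β b S f (Pi.single μ (-1)) s) := by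
  rw [negativeFm_eq_fm]
  simp only [fm_eq_integral]
  set P := qcdLatticeMeasure (2 * S + 1) β b
  haveI : IsProbabilityMeasure P := isProbabilityMeasure_qcdLatticeMeasure_all (S := 2 * S + 1) β b
  have hint : ∀ v, Integrable (fun U => propSum Nf S b f v U ^ s) P := fun v =>
    integrable_propSum_rpow Nf S β b f v hs0.le hs1
  have hint2 : ∀ μ : Fin 4, Integrable (fun U =>
      propSum Nf S b f (Pi.single μ 1) U ^ s + propSum Nf S b f (Pi.single μ (-1)) U ^ s) P := fun μ =>
    (hint _).add (hint _)
  have hsum := integrable_finsetSum Finset.univ fun μ _ => hint2 μ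
  -- integrate the a.s. configuration-wise floor (every sea determinant is a.s. non-zero)
  have hI : ∫ _U, (12 : ℝ) ^ s ∂P ≤ ∫ U, (|b f + 4| ^ s * propSum Nf S b f 0 U ^ s + (1 / 2 : ℝ) ^ s *
      ∑ μ : Fin 4, (propSum Nf S b f (Pi.single μ 1) U ^ s + propSum Nf S b f (Pi.single μ (-1)) U ^ s)) ∂P :=
    integral_mono_ae (integrable_const _) (((hint 0).const_mul _).add (hsum.const_mul _)) <| by
      filter_upwards [ae_fermionDet_ne_zero_qcdLatticeMeasure (S := 2 * S + 1) β b] with U hU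
      exact propSum_shell_floor_rpow b f U hU hs0 hs1
  rw [integral_const, probReal_univ, one_smul, integral_add ((hint 0).const_mul _) (hsum.const_mul _),
    integral_const_mul, integral_const_mul, integral_finsetSum _ fun μ _ => hint2 μ] at hI
  refine hI.trans_eq ?_
  congr 2
  exact Finset.sum_congr rfl fun μ _ => integral_add (hint _) (hint _)

/-- **THE SHELL FLOOR, first-moment form** (`s = 1`; the currency of node `AnchorFloorFinite`).  For every `N_f`,
coupling `β`, bare tuple `b`, half-side `S` and flavour `f`:
`12 ≤ |b_f + 4| · fm(0, 1) + ½ · Σ_μ (fm(e_μ, 1) + fm(−e_μ, 1))`. -/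
theorem fm_shell_floor (β : ℝ) (b : Fin Nf → ℝ) (S : ℕ) (f : Fin Nf) :
    (12 : ℝ) ≤ |b f + 4| * fm Nf β b S f 0 1 +
      (1 / 2 : ℝ) * ∑ μ : Fin 4, (fm Nf β b S f (Pi.single μ 1) 1 + fm Nf β b S f (Pi.single μ (-1)) 1) := by
  have h := fm_shell_floor_rpow β b S f one_pos le_rfl
  simp only [Real.rpow_one] at h
  exact h

/-- Parity: the backward-neighbour moment equals the forward one (`phaseQuenched_twoPoint_neg`). -/
private theorem fm_single_neg_one (β : ℝ) (b : Fin Nf → ℝ) (S : ℕ) (f : Fin Nf) (μ : Fin 4) (s : ℝ) :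
    fm Nf β b S f (Pi.single μ (-1)) s = fm Nf β b S f (Pi.single μ 1) s := by
  unfold MobilityGapNegative.fm
  rw [Pi.single_neg, phaseQuenched_twoPoint_neg]

/-- **Folded shell floor**: `12 ≤ |b_f + 4| · fm(0, 1) + Σ_μ fm(e_μ, 1)` (backward neighbours folded onto the
forward ones by parity). -/
theorem fm_shell_floor_folded (β : ℝ) (b : Fin Nf → ℝ) (S : ℕ) (f : Fin Nf) :
    (12 : ℝ) ≤ |b f + 4| * fm Nf β b S f 0 1 + ∑ μ : Fin 4, fm Nf β b S f (Pi.single μ 1) 1 := by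
  have h := fm_shell_floor β b S f
  simp only [fm_single_neg_one, ← two_mul, ← Finset.mul_sum] at h
  linarith

/-- **Not all five can be small.**  One of the first moments `fm(0,1)`, `fm(e_μ,1)` (`μ = 0,…,3`) is at least
`12 / (|b_f + 4| + 4)` — for every `N_f`, `β`, `b`, `S`, `f`. -/
theorem exists_shell_fm_ge (β : ℝ) (b : Fin Nf → ℝ) (S : ℕ) (f : Fin Nf) :
    12 / (|b f + 4| + 4) ≤ fm Nf β b S f 0 1 ∨
      ∃ μ : Fin 4, 12 / (|b f + 4| + 4) ≤ fm Nf β b S f (Pi.single μ 1) 1 := by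
  by_contra h
  simp only [not_or, not_exists, not_le] at h
  have hpos : 0 < |b f + 4| + 4 := by positivity
  have hc : 12 / (|b f + 4| + 4) * (|b f + 4| + 4) = 12 := div_mul_cancel₀ _ hpos.ne'
  have hsum : ∑ μ : Fin 4, fm Nf β b S f (Pi.single μ 1) 1 < ∑ _μ : Fin 4, 12 / (|b f + 4| + 4) :=
    Finset.sum_lt_sum_of_nonempty Finset.univ_nonempty fun μ _ => h.2 μ
  simp only [Finset.sum_const, Finset.card_univ, Fintype.card_fin, nsmul_eq_mul, Nat.cast_ofNat] at hsum
  nlinarith [fm_shell_floor_folded β b S f, mul_le_mul_of_nonneg_left h.1.le (abs_nonneg (b f + 4))]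

/-! ### §4 Along the anchored trajectory of `anchorReg N_f` -/

/-- **The shell floor along the anchored witness** (a kernel-checked SANITY FLOOR for node `AnchorFloorFinite`):
for every `N_f`, `t > 0`, EVERY `k`, every half-side `S` and flavour `f`, one of the five first moments
`fm(0,1)`, `fm(e_μ,1)` of the entry sum along `b_k = bare (anchorReg N_f) (t,…,t) k` at coupling `β_k` is at least
`12 / (8 + a_k t / Z_m(k))` (`-1 < b_f(k) ≤ a_k t / Z_m(k)` since `anchorThr ∈ [-1, 0]`) — uniformly in the volume;
in particular the `n ∈ {0, 1}` instances of the node cannot fail together with the three forward spatial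
unit-neighbour moments.  Nothing is claimed at separations `n ≥ 2`. -/
theorem anchor_shell_fm_ge (Nf : ℕ) {t : ℝ} (ht : 0 < t) (k S : ℕ) (f : Fin Nf) :
    12 / (8 + anchorA k * t / anchorZm Nf k) ≤
        fm Nf ((anchorReg Nf).β k) (bare (anchorReg Nf) (fun _ => t) k) S f 0 1 ∨
      ∃ μ : Fin 4, 12 / (8 + anchorA k * t / anchorZm Nf k) ≤
        fm Nf ((anchorReg Nf).β k) (bare (anchorReg Nf) (fun _ => t) k) S f (Pi.single μ 1) 1 := by
  -- `|b_f(k) + 4| + 4 ≤ 8 + a_k t / Z_m(k)`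
  have h1 := neg_one_le_anchorThr Nf ((anchorReg Nf).β k) ((anchorReg Nf).L k)
  have h2 := anchorThr_le_zero Nf ((anchorReg Nf).β k) ((anchorReg Nf).L k)
  have hincr : 0 < anchorA k * t / anchorZm Nf k := div_pos (mul_pos (anchorA_pos k) ht) (anchorZm_pos Nf k)
  have hb : bare (anchorReg Nf) (fun _ => t) k f =
      anchorThr Nf ((anchorReg Nf).β k) ((anchorReg Nf).L k) + anchorA k * t / anchorZm Nf k := rfl
  have hB : |bare (anchorReg Nf) (fun _ => t) k f + 4| + 4 ≤ 8 + anchorA k * t / anchorZm Nf k := by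
    rw [hb, abs_of_pos (by linarith)]
    linarith
  have hmono : 12 / (8 + anchorA k * t / anchorZm Nf k) ≤
      12 / (|bare (anchorReg Nf) (fun _ => t) k f + 4| + 4) :=
    div_le_div_of_nonneg_left (by norm_num) (by positivity) hB
  rcases exists_shell_fm_ge ((anchorReg Nf).β k) (bare (anchorReg Nf) (fun _ => t) k) S f with h | ⟨μ, h⟩
  · exact Or.inl (hmono.trans h)
  · exact Or.inr ⟨μ, hmono.trans h⟩

end QCD

end Summit.QuantumFields.QCD.Theorems.ChiralMobilityGapAnchor

end
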